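import Literature.Barriers.ValiantsHypothesis.MonotoneGapPermanentLower
import Literature.Barriers.ValiantsHypothesis.MonotoneGapPermanentUpper
import HarnessLib

/-!
# The monotone gap: discharge of `JerrumSnir1982_permanent` (J. ACM 29 (1982), §4.3)

Sibling of `Literature/Barriers/ValiantsHypothesis/MonotoneGap.lean` (next to
`MonotoneGapProofs.lean`, which discharges `JerrumSnir1982_spanningTree`) assembling the proof of
the named fact `JerrumSnir1982_permanent` stated there — Jerrum–Snir's exact determination of the
monotone `⊗`-complexity of the `n × n` permanent, `n (2^{n-1} - 1)` — from

* the lower bound `JerrumSnir.le_prodCount_perPoly` (`MonotoneGapPermanentLower.lean`: JS §3,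
  Cor. 3.5, with the content bound `δ(r,d) = d!(r-d)!(n-r)!` and the weight function
  `w(n) = (2^{n-1}-1)/(n-1)!` of §4.3, `MonotoneGapParseTrees.lean`, `MonotoneGapPermanentWeights.lean`);
* the upper bound `JerrumSnir.exists_isMonotoneComputation_perPoly`
  (`MonotoneGapPermanentUpper.lean`: the permanental Laplace expansion, p. 889).

## References

* [JerrumSnir1982] M. Jerrum, M. Snir, *Some exact complexity results for straight-line
  computations over semirings*, J. ACM 29 (1982) 874–897, §3 (Thm. 3.2–3.4, Cor. 3.5, Lemma 3.6),
  §4.3 (pp. 887–889).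
-/

namespace Literature.Barriers.ValiantsHypothesis

/-- **Jerrum–Snir 1982, §4.3 (discharge of the named fact `JerrumSnir1982_permanent`).** For every
`n ≥ 1`, every monotone computation of `per_n` over `ℝ≥0` has at least `n (2^{n-1} - 1)` product
gates, and the permanental Laplace expansion is a monotone computation with exactly that many:
"`⊗`-complexity of `p ≥ n!/(n-1)! · (2^{n-1} - 1) = n(2^{n-1} - 1)`. This lower bound is in fact
attained by the permanental equivalent of Laplace's expansion rule for determinants."
[cite: JerrumSnir1982, §4.3 (pp. 887–889) and Cor. 3.5] -/
theorem JerrumSnir1982_permanent_holds : JerrumSnir1982_permanent := fun _ hn =>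
  ⟨fun _ hP => JerrumSnir.le_prodCount_perPoly hn hP,
    JerrumSnir.exists_isMonotoneComputation_perPoly hn⟩

end Literature.Barriers.ValiantsHypothesis
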